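import Summits.CriticalPhenomena.PercolationContinuityZ3.Theorems.PercNearOneGluingNoHeavyQuantSingleMidTerms
import Summits.CriticalPhenomena.PercolationContinuityZ3.Theorems.PercNearOneGluingNoHeavyQuantLightSliceResidual
import Summits.CriticalPhenomena.PercolationContinuityZ3.Theorems.PercNearOneGluingNoHeavyQuantConvHeavy
import HarnessLib

/-!
# QUANT lane R8, T-DEC: THE LIGHT SLICE AS AN EIGHT-TERM LAW and its KNAPSACK FORM — the pooled residue of `LightSliceCore` reduced to
# explicit one-parameter inequalities in the usages (census-2 g59)

builds on p205010 (kernel theorem, internal audit signed; external expert review pending)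

Support file (`--supports stmt-CriticalPhenomena-4575`), QUANT lane seat prim-quant-census-2 (gen 59), rung R8 of
`run/shared/lean/prim/quant/LADDER.md`.  Memo `run/shared/lean/prim/quant/prim-quant-census-2-g59/ASSEMBLY-G59.md` §4.  Theorems only,
standard axioms, no sorries, no definitions.

THE OBJECT.  The light slice of side 1 in the binder of `LightSliceCore` / `LightSliceLowCross` / `LightSliceWide`,
`LS = lconv M₁ M₂ (TP[p, m; γ]) (atomLaw x T₂ j l h l′ h′)`, is the EIGHT-TERM law
`(1−γ)·(m_E δ_{p+l} + m_E c₁ δ_{p+h} + m_C δ_{p+l′} + m_C c₂ δ_{p+h′}) + γ·(m_E δ_{m+l} + m_E c₁ δ_{m+h} + m_C δ_{m+l′} + m_C c₂ δ_{m+h′})`,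
`c₁ = usage(l,h)`, `c₂ = usage(l′,h′)`, `m_E = (1−x)(u−c₂)/(c₁−c₂)`, `m_C = (1−x)(c₁−u)/(c₁−c₂)`, `u = x/(1−x)` (`lightSlice_eq_terms`; the terms may
land on coinciding positions, e.g. Type I `h = h′`).  With the head cell `h₀ = p + h′` of the light row as THE mid, the single-mid criterion for laws
given by terms (`decAtT_of_singleMid_terms`, `…QuantSingleMidTerms`) turns "LS is DEC at `(T₁+T₂, j)`" into the KNAPSACK INEQUALITIES:
* **`LawDec.lightSlice_decAtT_of_terms`** — generic form: the eight terms with the classification `if`s (low / giant / at the mid / compatible)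
  left to the user (every residue class: Type I or crossed Type II, low-cross or wide, evaluates them from its own hypotheses).
* **`LawDec.lightSlice_decAtT_crossGiant_of_knapsack`** — the crossed Type II class with the lower cross cell of the expensive piece a giant
  (`j + 1 ≤ p + h`; 4 872 + 56… instances of `LightSliceLowCross` at M ≤ 7), all `if`s evaluated: lows `p+l, p+l′, m+l, m+l′`, mid `p+h′`
  (mass `(1−γ)m_C c₂`), giants `p+h, m+h, m+h′` (mass `m_E c₁ + γ m_C c₂`):
  `u·(incompatible low mass) ≤ G` and `∀ θ ≥ 0, Σ_{q low} LS(q)·(T < q + h₀ ? min(usage(q,h₀),θ) : θ) ≤ (1−γ)m_C c₂ + θ·G/u` ⟹ LS DEC.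
EXACT CENSUS (census-2 g59 `code/resid_knap.py`; M ≤ 6 local, kit j163808 M ≤ 8): the criterion with this mid certifies EVERY residue instance
(2 138 / 2 138 at M ≤ 6; usage order `M2 < M1 < P1, P2`, census-1's PH-greedy), minimal relative slack ≈ 3 %.

[this work]; LP duality [cite: Schrijver1986, Cor 7.1f (p. 90)] via `…QuantLawDecStrongDuality`.  The gluing rows served
[cite: KozmaNitzan2024, Conjecture 3 (p. 15)]; product measure [cite: Grimmett1999, §1.3 p. 10].
-/

noncomputable section

namespace Summit.CriticalPhenomena.PercolationContinuityZ3.Theorems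

namespace Quant

open Finset

/-- the two-point law `{lo, hi; g}` (as in `…QuantLawDEC`) -/
local notation3 "TP[" lo ", " hi ", " g ", " h "]" =>
  (g : ℝ) * (if (h : ℕ) = (hi : ℕ) then (1 : ℝ) else 0) + (1 - (g : ℝ)) * (if (h : ℕ) = (lo : ℕ) then (1 : ℝ) else 0)

/-- the law `μ` shifted up by `s` (as in `…QuantConvHeavy`) -/
local notation3 "SH[" μ ", " s ", " h "]" => (if (s : ℕ) ≤ (h : ℕ) then (μ : ℕ → ℝ) ((h : ℕ) - (s : ℕ)) else (0 : ℝ))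

namespace LawDec

/-- indicator of equality of naturals, as a real number -/
local notation3 "𝟙[" a ", " b "]" => (if (a : ℕ) = (b : ℕ) then (1 : ℝ) else 0)

/-! ### The atom and its shifts as four terms -/

section Terms

variable (x T : ℝ) (j l h l' h' : ℕ)

/-- **the atom as four terms** (no distinctness of the positions needed): expensive low mass `m_E = (1−x)(u − c₂)/(c₁ − c₂)` at `l`, `m_E c₁` at
`h`, cheap low mass `m_C = (1−x)(c₁ − u)/(c₁ − c₂)` at `l′`, `m_C c₂` at `h′`. [this work] -/
theorem atomLaw_eq_terms (b : ℕ) :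
    atomLaw x T j l h l' h' b
      = ((1 - x) / (usage x T j l h - usage x T j l' h') * (x / (1 - x) - usage x T j l' h')) * 𝟙[b, l]
        + ((1 - x) / (usage x T j l h - usage x T j l' h') * (x / (1 - x) - usage x T j l' h')) * usage x T j l h * 𝟙[b, h]
        + ((1 - x) / (usage x T j l h - usage x T j l' h') * (usage x T j l h - x / (1 - x))) * 𝟙[b, l']
        + ((1 - x) / (usage x T j l h - usage x T j l' h') * (usage x T j l h - x / (1 - x))) * usage x T j l' h' * 𝟙[b, h'] := by
  unfold atomLaw
  ring

/-- **a shift of the atom as four terms.** [this work] -/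
theorem shift_atomLaw_eq_terms (s q : ℕ) :
    SH[atomLaw x T j l h l' h', s, q]
      = ((1 - x) / (usage x T j l h - usage x T j l' h') * (x / (1 - x) - usage x T j l' h')) * 𝟙[q, s + l]
        + ((1 - x) / (usage x T j l h - usage x T j l' h') * (x / (1 - x) - usage x T j l' h')) * usage x T j l h * 𝟙[q, s + h]
        + ((1 - x) / (usage x T j l h - usage x T j l' h') * (usage x T j l h - x / (1 - x))) * 𝟙[q, s + l']
        + ((1 - x) / (usage x T j l h - usage x T j l' h') * (usage x T j l h - x / (1 - x))) * usage x T j l' h' * 𝟙[q, s + h'] := by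
  by_cases hsq : s ≤ q
  · rw [if_pos hsq, atomLaw_eq_terms]
    have e : ∀ k : ℕ, (𝟙[q - s, k]) = 𝟙[q, s + k] := by
      intro k
      by_cases hk : q - s = k
      · rw [if_pos hk, if_pos (by omega)]
      · rw [if_neg hk, if_neg (by omega)]
    rw [e l, e h, e l', e h']
  · rw [if_neg hsq, if_neg (by omega), if_neg (by omega), if_neg (by omega), if_neg (by omega)]
    ring

end Terms

/-! ### The light slice as eight terms -/

/-- **THE LIGHT SLICE IS AN EIGHT-TERM LAW**: with `c = ![(1−γ)m_E, (1−γ)m_E c₁, (1−γ)m_C, (1−γ)m_C c₂, γm_E, γm_E c₁, γm_C, γm_C c₂]` and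
`pos = ![p+l, p+h, p+l′, p+h′, m+l, m+h, m+l′, m+h′]`, `lconv M₁ M₂ (TP[p,m;γ]) (atomLaw) = Σ_i c_i δ_{pos_i}`. [this work] -/
theorem lightSlice_eq_terms (x T₂ γ : ℝ) (M₁ M₂ j p m l h l' h' : ℕ) (hlM : l ≤ M₂) (hhM : h ≤ M₂) (hl'M : l' ≤ M₂) (hh'M : h' ≤ M₂)
    (hpM : p ≤ M₁) (hmM : m ≤ M₁) :
    lconv M₁ M₂ (fun b => TP[p, m, γ, b]) (atomLaw x T₂ j l h l' h')
      = fun q => ∑ i : Fin 8,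
          (![(1 - γ) * ((1 - x) / (usage x T₂ j l h - usage x T₂ j l' h') * (x / (1 - x) - usage x T₂ j l' h')),
              (1 - γ) * ((1 - x) / (usage x T₂ j l h - usage x T₂ j l' h') * (x / (1 - x) - usage x T₂ j l' h') * usage x T₂ j l h),
              (1 - γ) * ((1 - x) / (usage x T₂ j l h - usage x T₂ j l' h') * (usage x T₂ j l h - x / (1 - x))),
              (1 - γ) * ((1 - x) / (usage x T₂ j l h - usage x T₂ j l' h') * (usage x T₂ j l h - x / (1 - x)) * usage x T₂ j l' h'),
              γ * ((1 - x) / (usage x T₂ j l h - usage x T₂ j l' h') * (x / (1 - x) - usage x T₂ j l' h')),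
              γ * ((1 - x) / (usage x T₂ j l h - usage x T₂ j l' h') * (x / (1 - x) - usage x T₂ j l' h') * usage x T₂ j l h),
              γ * ((1 - x) / (usage x T₂ j l h - usage x T₂ j l' h') * (usage x T₂ j l h - x / (1 - x))),
              γ * ((1 - x) / (usage x T₂ j l h - usage x T₂ j l' h') * (usage x T₂ j l h - x / (1 - x)) * usage x T₂ j l' h')] : Fin 8 → ℝ) i
            * (if q = (![p + l, p + h, p + l', p + h', m + l, m + h, m + l', m + h'] : Fin 8 → ℕ) i then (1 : ℝ) else 0) := by
  have hz : ∀ b, M₂ < b → atomLaw x T₂ j l h l' h' b = 0 := fun b hb => atomLaw_eq_zero_of_gt x T₂ j l h l' h' hlM hhM hl'M hh'M hb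
  funext q
  rw [lconv_comm, lconv_TP M₂ M₁ p m _ γ hz hpM hmM, shift_atomLaw_eq_terms x T₂ j l h l' h' p q, shift_atomLaw_eq_terms x T₂ j l h l' h' m q]
  simp only [Fin.sum_univ_eight, Matrix.cons_val_zero, Matrix.cons_val_one, Matrix.cons_val]
  ring

/-! ### The knapsack form -/

/-- **THE LIGHT SLICE IN KNAPSACK FORM (generic classification).**  Floor `0 < x < 1`, a light credit pair `{p, m}` of side 1 with gate
`γ ∈ [0,1]`, admissible-type rates on side 2 (`0 ≤ c₂ < u < c₁`, so the atom masses are nonnegative), all positions below the top `M₁ + M₂`, a mid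
`h₀ ≤ j` with `T ≤ 2h₀`.  If the eight terms satisfy the two hypotheses of `decAtT_of_singleMid_terms` (incompatible low mass vs giant mass; the
knapsack inequality for every `θ ≥ 0`), the light slice is `DECAtT x T j (M₁ + M₂)`.  [this work] -/
theorem lightSlice_decAtT_of_terms (x T T₂ γ : ℝ) (M₁ M₂ j h₀ p m l h l' h' : ℕ) (hx0 : 0 < x) (hx1 : x < 1)
    (hγ0 : 0 ≤ γ) (hγ1 : γ ≤ 1) (hc₂0 : 0 ≤ usage x T₂ j l' h') (hc₂u : usage x T₂ j l' h' < x / (1 - x)) (huc₁ : x / (1 - x) < usage x T₂ j l h)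
    (hlM : l ≤ M₂) (hhM : h ≤ M₂) (hl'M : l' ≤ M₂) (hh'M : h' ≤ M₂) (hpM : p ≤ M₁) (hmM : m ≤ M₁)
    (hh₀j : h₀ ≤ j) (hh₀M : h₀ ≤ M₁ + M₂) (hh₀T : T ≤ 2 * (h₀ : ℝ))
    (hinc : x / (1 - x) * ∑ i : Fin 8,
        (if (![p + l, p + h, p + l', p + h', m + l, m + h, m + l', m + h'] : Fin 8 → ℕ) i ≤ j ∧
            2 * (((![p + l, p + h, p + l', p + h', m + l, m + h, m + l', m + h'] : Fin 8 → ℕ) i : ℕ) : ℝ) < T ∧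
            ¬ (T < (((![p + l, p + h, p + l', p + h', m + l, m + h, m + l', m + h'] : Fin 8 → ℕ) i : ℕ) : ℝ) + h₀) then
          (![(1 - γ) * ((1 - x) / (usage x T₂ j l h - usage x T₂ j l' h') * (x / (1 - x) - usage x T₂ j l' h')),
              (1 - γ) * ((1 - x) / (usage x T₂ j l h - usage x T₂ j l' h') * (x / (1 - x) - usage x T₂ j l' h') * usage x T₂ j l h),
              (1 - γ) * ((1 - x) / (usage x T₂ j l h - usage x T₂ j l' h') * (usage x T₂ j l h - x / (1 - x))),
              (1 - γ) * ((1 - x) / (usage x T₂ j l h - usage x T₂ j l' h') * (usage x T₂ j l h - x / (1 - x)) * usage x T₂ j l' h'),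
              γ * ((1 - x) / (usage x T₂ j l h - usage x T₂ j l' h') * (x / (1 - x) - usage x T₂ j l' h')),
              γ * ((1 - x) / (usage x T₂ j l h - usage x T₂ j l' h') * (x / (1 - x) - usage x T₂ j l' h') * usage x T₂ j l h),
              γ * ((1 - x) / (usage x T₂ j l h - usage x T₂ j l' h') * (usage x T₂ j l h - x / (1 - x))),
              γ * ((1 - x) / (usage x T₂ j l h - usage x T₂ j l' h') * (usage x T₂ j l h - x / (1 - x)) * usage x T₂ j l' h')] : Fin 8 → ℝ) i
          else 0)
      ≤ ∑ i : Fin 8, (if j + 1 ≤ (![p + l, p + h, p + l', p + h', m + l, m + h, m + l', m + h'] : Fin 8 → ℕ) i then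
          (![(1 - γ) * ((1 - x) / (usage x T₂ j l h - usage x T₂ j l' h') * (x / (1 - x) - usage x T₂ j l' h')),
              (1 - γ) * ((1 - x) / (usage x T₂ j l h - usage x T₂ j l' h') * (x / (1 - x) - usage x T₂ j l' h') * usage x T₂ j l h),
              (1 - γ) * ((1 - x) / (usage x T₂ j l h - usage x T₂ j l' h') * (usage x T₂ j l h - x / (1 - x))),
              (1 - γ) * ((1 - x) / (usage x T₂ j l h - usage x T₂ j l' h') * (usage x T₂ j l h - x / (1 - x)) * usage x T₂ j l' h'),
              γ * ((1 - x) / (usage x T₂ j l h - usage x T₂ j l' h') * (x / (1 - x) - usage x T₂ j l' h')),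
              γ * ((1 - x) / (usage x T₂ j l h - usage x T₂ j l' h') * (x / (1 - x) - usage x T₂ j l' h') * usage x T₂ j l h),
              γ * ((1 - x) / (usage x T₂ j l h - usage x T₂ j l' h') * (usage x T₂ j l h - x / (1 - x))),
              γ * ((1 - x) / (usage x T₂ j l h - usage x T₂ j l' h') * (usage x T₂ j l h - x / (1 - x)) * usage x T₂ j l' h')] : Fin 8 → ℝ) i
          else 0))
    (hknap : ∀ θ : ℝ, 0 ≤ θ →
      ∑ i : Fin 8, (if (![p + l, p + h, p + l', p + h', m + l, m + h, m + l', m + h'] : Fin 8 → ℕ) i ≤ j ∧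
            2 * (((![p + l, p + h, p + l', p + h', m + l, m + h, m + l', m + h'] : Fin 8 → ℕ) i : ℕ) : ℝ) < T then
          (![(1 - γ) * ((1 - x) / (usage x T₂ j l h - usage x T₂ j l' h') * (x / (1 - x) - usage x T₂ j l' h')),
              (1 - γ) * ((1 - x) / (usage x T₂ j l h - usage x T₂ j l' h') * (x / (1 - x) - usage x T₂ j l' h') * usage x T₂ j l h),
              (1 - γ) * ((1 - x) / (usage x T₂ j l h - usage x T₂ j l' h') * (usage x T₂ j l h - x / (1 - x))),
              (1 - γ) * ((1 - x) / (usage x T₂ j l h - usage x T₂ j l' h') * (usage x T₂ j l h - x / (1 - x)) * usage x T₂ j l' h'),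
              γ * ((1 - x) / (usage x T₂ j l h - usage x T₂ j l' h') * (x / (1 - x) - usage x T₂ j l' h')),
              γ * ((1 - x) / (usage x T₂ j l h - usage x T₂ j l' h') * (x / (1 - x) - usage x T₂ j l' h') * usage x T₂ j l h),
              γ * ((1 - x) / (usage x T₂ j l h - usage x T₂ j l' h') * (usage x T₂ j l h - x / (1 - x))),
              γ * ((1 - x) / (usage x T₂ j l h - usage x T₂ j l' h') * (usage x T₂ j l h - x / (1 - x)) * usage x T₂ j l' h')] : Fin 8 → ℝ) i
            * (if T < (((![p + l, p + h, p + l', p + h', m + l, m + h, m + l', m + h'] : Fin 8 → ℕ) i : ℕ) : ℝ) + h₀ then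
                min (usage x T j ((![p + l, p + h, p + l', p + h', m + l, m + h, m + l', m + h'] : Fin 8 → ℕ) i) h₀) θ else θ)
          else 0)
        ≤ (∑ i : Fin 8, (if (![p + l, p + h, p + l', p + h', m + l, m + h, m + l', m + h'] : Fin 8 → ℕ) i = h₀ then
            (![(1 - γ) * ((1 - x) / (usage x T₂ j l h - usage x T₂ j l' h') * (x / (1 - x) - usage x T₂ j l' h')),
              (1 - γ) * ((1 - x) / (usage x T₂ j l h - usage x T₂ j l' h') * (x / (1 - x) - usage x T₂ j l' h') * usage x T₂ j l h),
              (1 - γ) * ((1 - x) / (usage x T₂ j l h - usage x T₂ j l' h') * (usage x T₂ j l h - x / (1 - x))),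
              (1 - γ) * ((1 - x) / (usage x T₂ j l h - usage x T₂ j l' h') * (usage x T₂ j l h - x / (1 - x)) * usage x T₂ j l' h'),
              γ * ((1 - x) / (usage x T₂ j l h - usage x T₂ j l' h') * (x / (1 - x) - usage x T₂ j l' h')),
              γ * ((1 - x) / (usage x T₂ j l h - usage x T₂ j l' h') * (x / (1 - x) - usage x T₂ j l' h') * usage x T₂ j l h),
              γ * ((1 - x) / (usage x T₂ j l h - usage x T₂ j l' h') * (usage x T₂ j l h - x / (1 - x))),
              γ * ((1 - x) / (usage x T₂ j l h - usage x T₂ j l' h') * (usage x T₂ j l h - x / (1 - x)) * usage x T₂ j l' h')] : Fin 8 → ℝ) i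
            else 0))
          + θ * ((1 - x) / x) * ∑ i : Fin 8, (if j + 1 ≤ (![p + l, p + h, p + l', p + h', m + l, m + h, m + l', m + h'] : Fin 8 → ℕ) i then
            (![(1 - γ) * ((1 - x) / (usage x T₂ j l h - usage x T₂ j l' h') * (x / (1 - x) - usage x T₂ j l' h')),
              (1 - γ) * ((1 - x) / (usage x T₂ j l h - usage x T₂ j l' h') * (x / (1 - x) - usage x T₂ j l' h') * usage x T₂ j l h),
              (1 - γ) * ((1 - x) / (usage x T₂ j l h - usage x T₂ j l' h') * (usage x T₂ j l h - x / (1 - x))),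
              (1 - γ) * ((1 - x) / (usage x T₂ j l h - usage x T₂ j l' h') * (usage x T₂ j l h - x / (1 - x)) * usage x T₂ j l' h'),
              γ * ((1 - x) / (usage x T₂ j l h - usage x T₂ j l' h') * (x / (1 - x) - usage x T₂ j l' h')),
              γ * ((1 - x) / (usage x T₂ j l h - usage x T₂ j l' h') * (x / (1 - x) - usage x T₂ j l' h') * usage x T₂ j l h),
              γ * ((1 - x) / (usage x T₂ j l h - usage x T₂ j l' h') * (usage x T₂ j l h - x / (1 - x))),
              γ * ((1 - x) / (usage x T₂ j l h - usage x T₂ j l' h') * (usage x T₂ j l h - x / (1 - x)) * usage x T₂ j l' h')] : Fin 8 → ℝ) i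
            else 0)) :
    DECAtT x T j (M₁ + M₂) (lconv M₁ M₂ (fun b => TP[p, m, γ, b]) (atomLaw x T₂ j l h l' h')) := by
  have h1x : 0 < 1 - x := by linarith
  have hK : 0 ≤ (1 - x) / (usage x T₂ j l h - usage x T₂ j l' h') := div_nonneg h1x.le (by linarith)
  have hmE : 0 ≤ (1 - x) / (usage x T₂ j l h - usage x T₂ j l' h') * (x / (1 - x) - usage x T₂ j l' h') := mul_nonneg hK (by linarith)
  have hmC : 0 ≤ (1 - x) / (usage x T₂ j l h - usage x T₂ j l' h') * (usage x T₂ j l h - x / (1 - x)) := mul_nonneg hK (by linarith)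
  have hc₁0 : 0 ≤ usage x T₂ j l h := by have := div_pos hx0 h1x; linarith
  rw [lightSlice_eq_terms x T₂ γ M₁ M₂ j p m l h l' h' hlM hhM hl'M hh'M hpM hmM]
  refine decAtT_of_singleMid_terms x T j (M₁ + M₂) h₀ _ _ hx0 hx1 ?_ ?_ ?_ hh₀j hh₀M hh₀T hinc hknap
  · intro i
    fin_cases i <;> first
      | exact mul_nonneg (by linarith) hmE
      | exact mul_nonneg (by linarith) (mul_nonneg hmE hc₁0)
      | exact mul_nonneg (by linarith) hmC
      | exact mul_nonneg (by linarith) (mul_nonneg hmC hc₂0)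
  · -- total mass one
    have hcc : usage x T₂ j l h - usage x T₂ j l' h' ≠ 0 := by linarith
    have h1x' : (1 : ℝ) - x ≠ 0 := h1x.ne'
    simp only [Fin.sum_univ_eight, Matrix.cons_val_zero, Matrix.cons_val_one, Matrix.cons_val]
    field_simp
    ring
  · intro i
    fin_cases i <;> simp <;> omega


/-! ### The crossed Type II class with the lower cross cell a giant: all `if`s evaluated -/

/-- **KNAPSACK FORM OF THE CROSSED TYPE II LOW-CROSS CLASS WITH `p + h` A GIANT.**  Light pair `{p, m}` (`p < m`) with gate `γ ∈ [0,1]`, atom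
positions `l < l′`, `h′ ≤ h` with rates `0 ≤ c₂ < u < c₁`; the mid `h₀ = p + h′ ≤ j` with `T ≤ 2(p + h′)`; the cross cell `m + l′` a conv-low BELOW
the mid (`2(m + l′) < T`, `m + l′ < p + h′`); giants `p + h ≥ j + 1` (hence `m + h`) and `m + h′ ≥ j + 1`; tops `m ≤ M₁`, `h ≤ M₂`.  Then the four
lows are `p+l, p+l′, m+l, m+l′`, the mid carries `(1−γ)m_C c₂`, the giants carry `G = (1−γ)m_E c₁ + γm_E c₁ + γm_C c₂`, and the two knapsack
hypotheses (incompatible low mass `≤ G/u`; `∀ θ ≥ 0`, `Σ_{lows} mass·(compatible ? min(usage, θ) : θ) ≤ (1−γ)m_C c₂ + θ·G/u`) give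
`DECAtT x T j (M₁+M₂)` of the light slice. [this work] -/
theorem lightSlice_decAtT_crossGiant_of_knapsack (x T T₂ γ : ℝ) (M₁ M₂ j p m l h l' h' : ℕ) (hx0 : 0 < x) (hx1 : x < 1)
    (hγ0 : 0 ≤ γ) (hγ1 : γ ≤ 1) (hc₂0 : 0 ≤ usage x T₂ j l' h') (hc₂u : usage x T₂ j l' h' < x / (1 - x)) (huc₁ : x / (1 - x) < usage x T₂ j l h)
    (hpm : p < m) (hll' : l < l') (hh'h : h' ≤ h) (hmM : m ≤ M₁) (hhM : h ≤ M₂)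
    (hmidj : p + h' ≤ j) (hmidT : T ≤ 2 * ((p : ℝ) + h')) (hlow : 2 * ((m : ℝ) + l') < T) (hbelow : m + l' < p + h')
    (hPG : j + 1 ≤ p + h) (hMH : j + 1 ≤ m + h')
    (hinc : x / (1 - x) *
        ((if T < ((p : ℝ) + l) + ((p : ℝ) + h') then 0 else (1 - γ) * ((1 - x) / (usage x T₂ j l h - usage x T₂ j l' h') * (x / (1 - x) - usage x T₂ j l' h')))
        + (if T < ((p : ℝ) + l') + ((p : ℝ) + h') then 0 else (1 - γ) * ((1 - x) / (usage x T₂ j l h - usage x T₂ j l' h') * (usage x T₂ j l h - x / (1 - x))))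
        + (if T < ((m : ℝ) + l) + ((p : ℝ) + h') then 0 else γ * ((1 - x) / (usage x T₂ j l h - usage x T₂ j l' h') * (x / (1 - x) - usage x T₂ j l' h')))
        + (if T < ((m : ℝ) + l') + ((p : ℝ) + h') then 0 else γ * ((1 - x) / (usage x T₂ j l h - usage x T₂ j l' h') * (usage x T₂ j l h - x / (1 - x)))))
      ≤ (1 - γ) * ((1 - x) / (usage x T₂ j l h - usage x T₂ j l' h') * (x / (1 - x) - usage x T₂ j l' h') * usage x T₂ j l h)
        + γ * ((1 - x) / (usage x T₂ j l h - usage x T₂ j l' h') * (x / (1 - x) - usage x T₂ j l' h') * usage x T₂ j l h)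
        + γ * ((1 - x) / (usage x T₂ j l h - usage x T₂ j l' h') * (usage x T₂ j l h - x / (1 - x)) * usage x T₂ j l' h'))
    (hknap : ∀ θ : ℝ, 0 ≤ θ →
      (1 - γ) * ((1 - x) / (usage x T₂ j l h - usage x T₂ j l' h') * (x / (1 - x) - usage x T₂ j l' h'))
          * (if T < ((p : ℝ) + l) + ((p : ℝ) + h') then min (usage x T j (p + l) (p + h')) θ else θ)
        + (1 - γ) * ((1 - x) / (usage x T₂ j l h - usage x T₂ j l' h') * (usage x T₂ j l h - x / (1 - x)))
          * (if T < ((p : ℝ) + l') + ((p : ℝ) + h') then min (usage x T j (p + l') (p + h')) θ else θ)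
        + γ * ((1 - x) / (usage x T₂ j l h - usage x T₂ j l' h') * (x / (1 - x) - usage x T₂ j l' h'))
          * (if T < ((m : ℝ) + l) + ((p : ℝ) + h') then min (usage x T j (m + l) (p + h')) θ else θ)
        + γ * ((1 - x) / (usage x T₂ j l h - usage x T₂ j l' h') * (usage x T₂ j l h - x / (1 - x)))
          * (if T < ((m : ℝ) + l') + ((p : ℝ) + h') then min (usage x T j (m + l') (p + h')) θ else θ)
      ≤ (1 - γ) * ((1 - x) / (usage x T₂ j l h - usage x T₂ j l' h') * (usage x T₂ j l h - x / (1 - x)) * usage x T₂ j l' h')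
        + θ * ((1 - x) / x) *
          ((1 - γ) * ((1 - x) / (usage x T₂ j l h - usage x T₂ j l' h') * (x / (1 - x) - usage x T₂ j l' h') * usage x T₂ j l h)
            + γ * ((1 - x) / (usage x T₂ j l h - usage x T₂ j l' h') * (x / (1 - x) - usage x T₂ j l' h') * usage x T₂ j l h)
            + γ * ((1 - x) / (usage x T₂ j l h - usage x T₂ j l' h') * (usage x T₂ j l h - x / (1 - x)) * usage x T₂ j l' h'))) :
    DECAtT x T j (M₁ + M₂) (lconv M₁ M₂ (fun b => TP[p, m, γ, b]) (atomLaw x T₂ j l h l' h')) := by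
  -- positions of the four lows are at most `j` and conv-lows; the three giants lie above `j`; only `p + h′` is the mid
  have hq1 : p + l ≤ j ∧ 2 * ((p : ℝ) + l) < T := ⟨by omega, by
    have : ((p : ℝ) + l) ≤ (m : ℝ) + l' := by exact_mod_cast (show p + l ≤ m + l' by omega)
    linarith⟩
  have hq3 : p + l' ≤ j ∧ 2 * ((p : ℝ) + l') < T := ⟨by omega, by
    have : ((p : ℝ) + l') ≤ (m : ℝ) + l' := by exact_mod_cast (show p + l' ≤ m + l' by omega)
    linarith⟩
  have hq5 : m + l ≤ j ∧ 2 * ((m : ℝ) + l) < T := ⟨by omega, by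
    have : ((m : ℝ) + l) ≤ (m : ℝ) + l' := by exact_mod_cast (show m + l ≤ m + l' by omega)
    linarith⟩
  have hq7 : m + l' ≤ j ∧ 2 * ((m : ℝ) + l') < T := ⟨by omega, hlow⟩
  have hn2 : ¬ (p + h ≤ j ∧ 2 * ((p : ℝ) + h) < T) := fun hc => by omega
  have hn4 : ¬ (p + h' ≤ j ∧ 2 * ((p : ℝ) + h') < T) := fun hc => by linarith [hc.2]
  have hn6 : ¬ (m + h ≤ j ∧ 2 * ((m : ℝ) + h) < T) := fun hc => by omega
  have hn8 : ¬ (m + h' ≤ j ∧ 2 * ((m : ℝ) + h') < T) := fun hc => by omega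
  have hg1 : ¬ (j + 1 ≤ p + l) := by omega
  have hg2 : j + 1 ≤ p + h := hPG
  have hg3 : ¬ (j + 1 ≤ p + l') := by omega
  have hg4 : ¬ (j + 1 ≤ p + h') := by omega
  have hg5 : ¬ (j + 1 ≤ m + l) := by omega
  have hg6 : j + 1 ≤ m + h := by omega
  have hg7 : ¬ (j + 1 ≤ m + l') := by omega
  have hg8 : j + 1 ≤ m + h' := hMH
  have he1 : p + l ≠ p + h' := by omega
  have he2 : p + h ≠ p + h' := by omega
  have he3 : p + l' ≠ p + h' := by omega
  have he5 : m + l ≠ p + h' := by omega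
  have he6 : m + h ≠ p + h' := by omega
  have he7 : m + l' ≠ p + h' := by omega
  have he8 : m + h' ≠ p + h' := by omega
  refine lightSlice_decAtT_of_terms x T T₂ γ M₁ M₂ j (p + h') p m l h l' h' hx0 hx1 hγ0 hγ1 hc₂0 hc₂u huc₁
    (by omega) hhM (by omega) (by omega) (by omega) hmM hmidj (by omega) (by push_cast; exact hmidT) ?_ ?_
  · simp only [Fin.sum_univ_eight, Matrix.cons_val_zero, Matrix.cons_val_one, Matrix.cons_val, Nat.cast_add,
      if_neg hg1, if_pos hg2, if_neg hg3, if_neg hg4, if_neg hg5, if_pos hg6, if_neg hg7, if_pos hg8, zero_add, add_zero]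
    have r1 : ∀ (c : ℝ), (if p + l ≤ j ∧ 2 * ((p : ℝ) + l) < T ∧ ¬ (T < ((p : ℝ) + l) + ((p : ℝ) + h')) then c else 0)
        = (if T < ((p : ℝ) + l) + ((p : ℝ) + h') then 0 else c) := fun c => by
      by_cases hc : T < ((p : ℝ) + l) + ((p : ℝ) + h')
      · rw [if_pos hc, if_neg (by push Not; intro _ _; exact hc)]
      · rw [if_neg hc, if_pos ⟨hq1.1, hq1.2, hc⟩]
    have r3 : ∀ (c : ℝ), (if p + l' ≤ j ∧ 2 * ((p : ℝ) + l') < T ∧ ¬ (T < ((p : ℝ) + l') + ((p : ℝ) + h')) then c else 0)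
        = (if T < ((p : ℝ) + l') + ((p : ℝ) + h') then 0 else c) := fun c => by
      by_cases hc : T < ((p : ℝ) + l') + ((p : ℝ) + h')
      · rw [if_pos hc, if_neg (by push Not; intro _ _; exact hc)]
      · rw [if_neg hc, if_pos ⟨hq3.1, hq3.2, hc⟩]
    have r5 : ∀ (c : ℝ), (if m + l ≤ j ∧ 2 * ((m : ℝ) + l) < T ∧ ¬ (T < ((m : ℝ) + l) + ((p : ℝ) + h')) then c else 0)
        = (if T < ((m : ℝ) + l) + ((p : ℝ) + h') then 0 else c) := fun c => by
      by_cases hc : T < ((m : ℝ) + l) + ((p : ℝ) + h')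
      · rw [if_pos hc, if_neg (by push Not; intro _ _; exact hc)]
      · rw [if_neg hc, if_pos ⟨hq5.1, hq5.2, hc⟩]
    have r7 : ∀ (c : ℝ), (if m + l' ≤ j ∧ 2 * ((m : ℝ) + l') < T ∧ ¬ (T < ((m : ℝ) + l') + ((p : ℝ) + h')) then c else 0)
        = (if T < ((m : ℝ) + l') + ((p : ℝ) + h') then 0 else c) := fun c => by
      by_cases hc : T < ((m : ℝ) + l') + ((p : ℝ) + h')
      · rw [if_pos hc, if_neg (by push Not; intro _ _; exact hc)]
      · rw [if_neg hc, if_pos ⟨hq7.1, hq7.2, hc⟩]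
    have r2 : ∀ (c : ℝ), (if p + h ≤ j ∧ 2 * ((p : ℝ) + h) < T ∧ ¬ (T < ((p : ℝ) + h) + ((p : ℝ) + h')) then c else 0) = 0 :=
      fun c => if_neg (fun hc => hn2 ⟨hc.1, hc.2.1⟩)
    have r4 : ∀ (c : ℝ), (if p + h' ≤ j ∧ 2 * ((p : ℝ) + h') < T ∧ ¬ (T < ((p : ℝ) + h') + ((p : ℝ) + h')) then c else 0) = 0 :=
      fun c => if_neg (fun hc => hn4 ⟨hc.1, hc.2.1⟩)
    have r6 : ∀ (c : ℝ), (if m + h ≤ j ∧ 2 * ((m : ℝ) + h) < T ∧ ¬ (T < ((m : ℝ) + h) + ((p : ℝ) + h')) then c else 0) = 0 :=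
      fun c => if_neg (fun hc => hn6 ⟨hc.1, hc.2.1⟩)
    have r8 : ∀ (c : ℝ), (if m + h' ≤ j ∧ 2 * ((m : ℝ) + h') < T ∧ ¬ (T < ((m : ℝ) + h') + ((p : ℝ) + h')) then c else 0) = 0 :=
      fun c => if_neg (fun hc => hn8 ⟨hc.1, hc.2.1⟩)
    rw [r1, r2, r3, r4, r5, r6, r7, r8, add_zero, add_zero, add_zero, add_zero]
    exact hinc
  · intro θ hθ
    have key := hknap θ hθ
    simp only [Fin.sum_univ_eight, Matrix.cons_val_zero, Matrix.cons_val_one, Matrix.cons_val, Nat.cast_add,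
      if_pos hq1, if_neg hn2, if_pos hq3, if_neg hn4, if_pos hq5, if_neg hn6, if_pos hq7, if_neg hn8,
      if_neg hg1, if_pos hg2, if_neg hg3, if_neg hg4, if_neg hg5, if_pos hg6, if_neg hg7, if_pos hg8,
      if_neg he1, if_neg he2, if_neg he3, if_neg he5, if_neg he6, if_neg he7, if_neg he8, if_true, zero_add, add_zero]
    exact key

end LawDec

end Quant

end Summit.CriticalPhenomena.PercolationContinuityZ3.Theorems
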